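import Mathlib
import Literature.Computability.AlgebraicComplexity.HessianAtOrigin
import Literature.Computability.AlgebraicComplexity.MignonRessayreBound

/-!
# Crux `GrenetZeon.TwoDimCoefficients` (stmt-ValiantsHypothesis-8062) / rung `DualUnipotentThreeHalves` (stmt-24318):
# thin-numerator Hessian bound, part 1 — the RESOLVENT CALCULUS (`c·D(adj A) = −adj A·D(A)·adj A`) and rank bookkeeping

Part 1 of 2 (part 2: `…DualUnipotentThinNumeratorHessian`, the bound `rank Hess_p tr(adj A·B) ≤ 2m·rank B(p) + 2·rank coeff(B)`
in the `hess0 ∘ transl` currency of ✓ `threeHalves_of_hessianRate`).  Contents (all [folklore], no definitions, no named facts):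

* §1 matrix calculus for a `ℂ`-derivation `D` of `ℂ[x_σ]` applied entrywise: Leibniz for products, trace, constants, and
  `C_smul_map_adjugate_derivation`: `det A = c` (constant) ⟹ `c·D(adj A) = −adj A·D(A)·adj A`; second-order version
  `C_smul_map_map_adjugate_derivation` when `D_u D_v A = 0` (affine entries).
* §2 `eval_derivation_derivation_trace_adjugate_mul` — the second derivative of the resolvent trace at a point:
  `(D_u D_v tr(adj A·B))(p) = c⁻²·tr((J A_u J A_v J + J A_v J A_u J)·B(p)) − c⁻¹·tr(J A_v J B_u) − c⁻¹·tr(J A_u J B_v)`,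
  `J = adj A(p)`, `A_u = (D_u A)(p)`, `B_u = (D_u B)(p)` (the «(★) tr(UPU′Q) + tr(UQU′P)» resolvent form of the g10 note, kernel).
* §3 rank bookkeeping over `ℂ`: `rank_of_trace_mul_mul_le` (`(s,t) ↦ tr(U_s U_t M)` has rank `≤ m·rank M`, via
  `Σ_i P_i Mᵀ Q_i`) and `rank_of_trace_mul_mul_coeff_le` (`(s,t) ↦ tr(U_s G B_t)` has rank `≤ rank coeff(B)`).

HONEST FRAMING: calculus lemmas for a helper of an ASIDE crux; nothing about the permanent is proved here; `stub_dualUnipotent`,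
the rung 24318, `stub_longMassSlowLawInv` and `VP ≠ VNP` are untouched.
-/

noncomputable section

set_option linter.dupNamespace false

namespace Summit.ValiantsHypothesis.ValiantsHypothesis.Theorems.GrenetZeon.ThinNumerator

open MvPolynomial Matrix
open Literature.Computability.AlgebraicComplexity

/-! ### §1 Matrix calculus for a derivation -/

section MatDeriv

variable {σ : Type*} {ι : Type*} (D : Derivation ℂ (MvPolynomial σ ℂ) (MvPolynomial σ ℂ))

/-- Leibniz rule for matrix products, entrywise derivation. [folklore] -/
theorem map_mul_derivation [Fintype ι] (X Y : Matrix ι ι (MvPolynomial σ ℂ)) :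
    (X * Y).map D = X.map D * Y + X * Y.map D := by
  refine Matrix.ext fun i j => ?_
  simp only [Matrix.map_apply, Matrix.mul_apply, Matrix.add_apply, map_sum, Derivation.leibniz,
    smul_eq_mul]
  rw [← Finset.sum_add_distrib]
  exact Finset.sum_congr rfl fun k _ => by ring

/-- A derivation commutes with the trace. [folklore] -/
theorem derivation_trace [Fintype ι] (X : Matrix ι ι (MvPolynomial σ ℂ)) :
    D X.trace = (X.map D).trace := by
  simp only [Matrix.trace, Matrix.diag_apply, map_sum, Matrix.map_apply]

/-- A `ℂ`-derivation of the polynomial ring kills constants. [folklore] -/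
theorem derivation_C (a : ℂ) : D (C a : MvPolynomial σ ℂ) = 0 := by
  rw [← MvPolynomial.algebraMap_eq]
  exact D.map_algebraMap a

/-- Entrywise derivation of a constant multiple. [folklore] -/
theorem map_C_smul_derivation (a : ℂ) (X : Matrix ι ι (MvPolynomial σ ℂ)) :
    ((C a : MvPolynomial σ ℂ) • X).map D = (C a : MvPolynomial σ ℂ) • X.map D := by
  refine Matrix.ext fun i j => ?_
  simp only [Matrix.map_apply, Matrix.smul_apply, smul_eq_mul, Derivation.leibniz, derivation_C]
  simp

/-- Entrywise derivation of a negative. [folklore] -/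
theorem map_neg_derivation (X : Matrix ι ι (MvPolynomial σ ℂ)) : (-X).map D = -(X.map D) := by
  refine Matrix.ext fun i j => ?_
  simp only [Matrix.map_apply, Matrix.neg_apply, map_neg]

/-- Entrywise derivation of a sum. [folklore] -/
theorem map_add_derivation (X Y : Matrix ι ι (MvPolynomial σ ℂ)) : (X + Y).map D = X.map D + Y.map D :=
  Matrix.map_add _ (map_add D) _ _

/-- Entrywise derivation of a constant matrix vanishes. [folklore] -/
theorem map_map_C_derivation (G : Matrix ι ι ℂ) :
    (G.map (C : ℂ → MvPolynomial σ ℂ)).map D = 0 := by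
  refine Matrix.ext fun i j => ?_
  simp only [Matrix.map_apply, derivation_C, Matrix.zero_apply]

/-- **Derivative of the adjugate of a matrix with constant determinant**:
`c · D(adj A) = −adj A · D(A) · adj A`. [folklore] -/
theorem C_smul_map_adjugate_derivation [Fintype ι] [DecidableEq ι]
    (A : Matrix ι ι (MvPolynomial σ ℂ)) {c : ℂ} (hdet : A.det = C c) :
    (C c : MvPolynomial σ ℂ) • A.adjugate.map D = -(A.adjugate * A.map D * A.adjugate) := by
  -- differentiate `adj A · A = det A • 1`
  have h1 : (A.adjugate * A).map D = 0 := by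
    rw [Matrix.adjugate_mul, hdet]
    refine Matrix.ext fun i j => ?_
    by_cases hij : i = j
    · subst hij
      simp only [Matrix.map_apply, Matrix.smul_apply, Matrix.one_apply_eq, smul_eq_mul, mul_one,
        derivation_C, Matrix.zero_apply]
    · simp only [Matrix.map_apply, Matrix.smul_apply, Matrix.one_apply_ne hij, smul_zero, map_zero,
        Matrix.zero_apply]
  rw [map_mul_derivation] at h1
  have h2 : A.adjugate.map D * A = -(A.adjugate * A.map D) := eq_neg_of_add_eq_zero_left h1
  have h3 : A.adjugate.map D * A * A.adjugate = (C c : MvPolynomial σ ℂ) • A.adjugate.map D := by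
    rw [Matrix.mul_assoc, Matrix.mul_adjugate, hdet, Matrix.mul_smul, Matrix.mul_one]
  rw [← h3, h2, neg_mul]

/-- **Second derivative of the adjugate**: differentiating `c · D_v(adj A) = −adj A · A_v · adj A` along a second
derivation `D_u` that kills `A_v := D_v(A)` (affine entries). [folklore] -/
theorem C_smul_map_map_adjugate_derivation [Fintype ι] [DecidableEq ι]
    (Du Dv : Derivation ℂ (MvPolynomial σ ℂ) (MvPolynomial σ ℂ))
    (A : Matrix ι ι (MvPolynomial σ ℂ)) {c : ℂ} (hdet : A.det = C c) (hA : (A.map Dv).map Du = 0) :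
    (C c : MvPolynomial σ ℂ) • (A.adjugate.map Dv).map Du =
      -(A.adjugate.map Du * A.map Dv * A.adjugate + A.adjugate * A.map Dv * A.adjugate.map Du) := by
  have h := congrArg (fun X : Matrix ι ι (MvPolynomial σ ℂ) => X.map Du)
    (C_smul_map_adjugate_derivation Dv A hdet)
  rw [map_C_smul_derivation, map_neg_derivation, map_mul_derivation, map_mul_derivation, hA,
    Matrix.mul_zero, add_zero] at h
  exact h

end MatDeriv

/-! ### §2 The second derivative of `tr(adj A · B)` at a point -/

section SecondDerivative

variable {σ : Type*} {m : ℕ}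

/-- Evaluation of a constant multiple of a polynomial matrix. [folklore] -/
theorem map_eval_C_smul (p : σ → ℂ) (a : ℂ) (X : Matrix (Fin m) (Fin m) (MvPolynomial σ ℂ)) :
    ((C a : MvPolynomial σ ℂ) • X).map (eval p) = a • X.map (eval p) := by
  refine Matrix.ext fun i j => ?_
  simp only [Matrix.map_apply, Matrix.smul_apply, smul_eq_mul, map_mul, eval_C]

/-- Evaluation of a sum of polynomial matrices. [folklore] -/
theorem map_eval_add (p : σ → ℂ) (X Y : Matrix (Fin m) (Fin m) (MvPolynomial σ ℂ)) :
    (X + Y).map (eval p) = X.map (eval p) + Y.map (eval p) := Matrix.map_add _ (map_add _) _ _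

/-- Evaluation of the negative of a polynomial matrix. [folklore] -/
theorem map_eval_neg (p : σ → ℂ) (X : Matrix (Fin m) (Fin m) (MvPolynomial σ ℂ)) :
    (-X).map (eval p) = -X.map (eval p) := Matrix.map_neg _ (map_neg _) _

/-- Evaluation of a product of polynomial matrices. [folklore] -/
theorem map_eval_mul (p : σ → ℂ) (X Y : Matrix (Fin m) (Fin m) (MvPolynomial σ ℂ)) :
    (X * Y).map (eval p) = X.map (eval p) * Y.map (eval p) := Matrix.map_mul

/-- Evaluation of the adjugate. [folklore] -/
theorem map_eval_adjugate (p : σ → ℂ) (A : Matrix (Fin m) (Fin m) (MvPolynomial σ ℂ)) :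
    A.adjugate.map (eval p) = (A.map (eval p)).adjugate := by
  have h := RingHom.map_adjugate (eval p) A
  simp only [RingHom.mapMatrix_apply] at h
  exact h

/-- **The second derivative of `tr(adj A · B)` at a point**, for `det A ≡ c ≠ 0` and two derivations `D_u`, `D_v`
whose composite kills the entries of `A` and `B` (affine entries):
`(D_u D_v tr(adj A·B))(p) = c⁻²·tr((J A_u J A_v J + J A_v J A_u J)·B(p)) − c⁻¹·tr(J A_v J B_u) − c⁻¹·tr(J A_u J B_v)`
with `J = adj A(p)`, `A_u = (D_u A)(p)`, `B_u = (D_u B)(p)` etc. [folklore] -/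
theorem eval_derivation_derivation_trace_adjugate_mul
    (Du Dv : Derivation ℂ (MvPolynomial σ ℂ) (MvPolynomial σ ℂ))
    (A B : Matrix (Fin m) (Fin m) (MvPolynomial σ ℂ)) {c : ℂ} (hc : c ≠ 0) (hdet : A.det = C c)
    (hAuv : (A.map Dv).map Du = 0) (hBuv : (B.map Dv).map Du = 0) (p : σ → ℂ)
    (Jp Au Av Bu Bv Bp : Matrix (Fin m) (Fin m) ℂ) (hJp : (A.map (eval p)).adjugate = Jp)
    (hAu : (A.map Du).map (eval p) = Au) (hAv : (A.map Dv).map (eval p) = Av)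
    (hBu : (B.map Du).map (eval p) = Bu) (hBv : (B.map Dv).map (eval p) = Bv) (hBp : B.map (eval p) = Bp) :
    eval p (Du (Dv (A.adjugate * B).trace)) =
      c⁻¹ * c⁻¹ * ((Jp * Au * Jp * Av * Jp + Jp * Av * Jp * Au * Jp) * Bp).trace
        - c⁻¹ * (Jp * Av * Jp * Bu).trace - c⁻¹ * (Jp * Au * Jp * Bv).trace := by
  -- first derivatives of the adjugate, evaluated
  have hJu : (A.adjugate.map Du).map (eval p) = -(c⁻¹ • (Jp * Au * Jp)) := by
    have h := congrArg (fun X : Matrix (Fin m) (Fin m) (MvPolynomial σ ℂ) => X.map (eval p))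
      (C_smul_map_adjugate_derivation Du A hdet)
    rw [map_eval_C_smul, map_eval_neg, map_eval_mul, map_eval_mul, map_eval_adjugate, hJp, hAu] at h
    have h2 : (A.adjugate.map Du).map (eval p) = c⁻¹ • (c • (A.adjugate.map Du).map (eval p)) := by
      rw [smul_smul, inv_mul_cancel₀ hc, one_smul]
    rw [h2, h, smul_neg]
  have hJv : (A.adjugate.map Dv).map (eval p) = -(c⁻¹ • (Jp * Av * Jp)) := by
    have h := congrArg (fun X : Matrix (Fin m) (Fin m) (MvPolynomial σ ℂ) => X.map (eval p))
      (C_smul_map_adjugate_derivation Dv A hdet)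
    rw [map_eval_C_smul, map_eval_neg, map_eval_mul, map_eval_mul, map_eval_adjugate, hJp, hAv] at h
    have h2 : (A.adjugate.map Dv).map (eval p) = c⁻¹ • (c • (A.adjugate.map Dv).map (eval p)) := by
      rw [smul_smul, inv_mul_cancel₀ hc, one_smul]
    rw [h2, h, smul_neg]
  -- the second derivative of the adjugate, evaluated
  have hJuv : ((A.adjugate.map Dv).map Du).map (eval p) =
      (c⁻¹ * c⁻¹) • (Jp * Au * Jp * Av * Jp + Jp * Av * Jp * Au * Jp) := by
    have h := congrArg (fun X : Matrix (Fin m) (Fin m) (MvPolynomial σ ℂ) => X.map (eval p))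
      (C_smul_map_map_adjugate_derivation Du Dv A hdet hAuv)
    rw [map_eval_C_smul, map_eval_neg, map_eval_add, map_eval_mul, map_eval_mul, map_eval_mul,
      map_eval_mul, map_eval_adjugate, hJp, hAv, hJu] at h
    have h2 : ((A.adjugate.map Dv).map Du).map (eval p) =
        c⁻¹ • (c • ((A.adjugate.map Dv).map Du).map (eval p)) := by
      rw [smul_smul, inv_mul_cancel₀ hc, one_smul]
    rw [h2, h]
    simp only [Matrix.neg_mul, Matrix.mul_neg, Matrix.smul_mul, Matrix.mul_smul, neg_add,
      neg_neg, smul_add, smul_smul, Matrix.mul_assoc]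
  -- differentiate the trace twice
  have h1 : Dv (A.adjugate * B).trace = (A.adjugate.map Dv * B + A.adjugate * B.map Dv).trace := by
    rw [derivation_trace, map_mul_derivation]
  have h2 : Du (Dv (A.adjugate * B).trace) =
      ((A.adjugate.map Dv).map Du * B + A.adjugate.map Dv * B.map Du +
        (A.adjugate.map Du * B.map Dv + A.adjugate * (B.map Dv).map Du)).trace := by
    rw [h1, derivation_trace, map_add_derivation, map_mul_derivation, map_mul_derivation]
  rw [h2, hBuv, Matrix.mul_zero, add_zero]
  have htr : ∀ X : Matrix (Fin m) (Fin m) (MvPolynomial σ ℂ),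
      eval p X.trace = (X.map (eval p)).trace := fun X => by
    simp only [Matrix.trace, Matrix.diag_apply, map_sum, Matrix.map_apply]
  rw [htr, map_eval_add, map_eval_add, map_eval_mul, map_eval_mul, map_eval_mul, hJuv, hJu, hJv, hBu,
    hBv, hBp]
  simp only [Matrix.trace_add, Matrix.smul_mul, Matrix.neg_mul, Matrix.trace_smul, Matrix.trace_neg,
    smul_eq_mul]
  ring

end SecondDerivative

/-! ### §3 Rank bookkeeping -/

section Rank

variable {σ : Type*} [Fintype σ] {m : ℕ}

/-- `rank(X + Y) ≤ rank X + rank Y` (via the tree's `rank_sum_le`). [folklore] -/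
theorem rank_add_le' {ι κ : Type*} [Fintype ι] [Fintype κ] (X Y : Matrix ι κ ℂ) :
    (X + Y).rank ≤ X.rank + Y.rank := by
  have h := rank_sum_le (Finset.univ : Finset (Fin 2)) ![X, Y]
  rw [Fin.sum_univ_two, Fin.sum_univ_two] at h
  simpa using h

/-- **`Φ₁` has rank `≤ m · rank B(p)`**: `tr(U_s U_t M) = Σ_i (P_i Mᵀ Q_i)_{st}` with
`P_i(s,k) = (U_s)_{ki}`, `Q_i(l,t) = (U_t)_{il}`, each summand of rank `≤ rank M`. [folklore] -/
theorem rank_of_trace_mul_mul_le (U : σ → Matrix (Fin m) (Fin m) ℂ) (M : Matrix (Fin m) (Fin m) ℂ) :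
    (Matrix.of fun s t : σ => (U s * U t * M).trace).rank ≤ m * M.rank := by
  have hsum : (Matrix.of fun s t : σ => (U s * U t * M).trace) =
      ∑ i : Fin m, (Matrix.of fun (s : σ) (k : Fin m) => U s k i) * Mᵀ * (Matrix.of fun (l : Fin m) (t : σ) => U t i l) := by
    refine Matrix.ext fun s t => ?_
    simp only [Matrix.of_apply, Matrix.trace, Matrix.diag_apply, Matrix.mul_apply, Matrix.sum_apply,
      Matrix.transpose_apply, Finset.sum_mul]
    -- LHS: Σ_x Σ_y Σ_z U s x z * U t z y * M y x ; RHS: Σ_a Σ_b Σ_c U s c a * M b c * U t a b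
    calc (∑ x, ∑ y, ∑ z, U s x z * U t z y * M y x)
        = ∑ x, ∑ z, ∑ y, U s x z * U t z y * M y x := Finset.sum_congr rfl fun x _ => Finset.sum_comm
      _ = ∑ z, ∑ x, ∑ y, U s x z * U t z y * M y x := Finset.sum_comm
      _ = ∑ z, ∑ y, ∑ x, U s x z * M y x * U t z y := Finset.sum_congr rfl fun z _ => by
          rw [Finset.sum_comm]
          exact Finset.sum_congr rfl fun y _ => Finset.sum_congr rfl fun x _ => by ring
  rw [hsum]
  refine (rank_sum_le _ _).trans ?_
  have hi : ∀ i : Fin m, ((Matrix.of fun (s : σ) (k : Fin m) => U s k i) * Mᵀ *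
      (Matrix.of fun (l : Fin m) (t : σ) => U t i l)).rank ≤ M.rank := fun i =>
    ((Matrix.rank_mul_le_left _ _).trans (Matrix.rank_mul_le_right _ _)).trans (Matrix.rank_transpose M).le
  refine (Finset.sum_le_sum fun i _ => hi i).trans ?_
  simp

/-- **`Φ₂` has rank `≤` the number of independent linear forms among the entries of `B`**:
`tr(U_s · G · B_t) = (P · E · L)_{st}` where `L(lk, t) = coeff_{x_t} B_{lk}` is the coefficient matrix of `B`. [folklore] -/
theorem rank_of_trace_mul_mul_coeff_le (U : σ → Matrix (Fin m) (Fin m) ℂ) (G : Matrix (Fin m) (Fin m) ℂ)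
    (B : Matrix (Fin m) (Fin m) (MvPolynomial σ ℂ)) :
    (Matrix.of fun s t : σ => (U s * G * B.map (coeff (Finsupp.single t 1))).trace).rank ≤
      (Matrix.of fun (lk : Fin m × Fin m) (t : σ) => coeff (Finsupp.single t 1) (B lk.1 lk.2)).rank := by
  classical
  set L : Matrix (Fin m × Fin m) σ ℂ := Matrix.of fun lk t => coeff (Finsupp.single t 1) (B lk.1 lk.2) with hL
  set P : Matrix σ (Fin m × Fin m) ℂ := Matrix.of fun s ik => U s ik.2 ik.1 with hP
  set E : Matrix (Fin m × Fin m) (Fin m × Fin m) ℂ :=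
    Matrix.of fun ik lk => if ik.2 = lk.2 then G ik.1 lk.1 else 0 with hE
  have hfac : (Matrix.of fun s t : σ => (U s * G * B.map (coeff (Finsupp.single t 1))).trace) = P * (E * L) := by
    refine Matrix.ext fun s t => ?_
    simp only [hP, hE, hL, Matrix.of_apply, Matrix.trace, Matrix.diag_apply, Matrix.mul_apply,
      Matrix.map_apply, Fintype.sum_prod_type, ite_mul, zero_mul, Finset.sum_ite_eq, Finset.mem_univ, if_true,
      Finset.sum_mul, Finset.mul_sum]
    -- LHS: Σ_x Σ_y Σ_z U s x z * G z y * B_t y x ; RHS: Σ_a Σ_b Σ_c U s b a * (G a c * B_t c b)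
    calc (∑ x, ∑ y, ∑ z, U s x z * G z y * coeff (Finsupp.single t 1) (B y x))
        = ∑ x, ∑ z, ∑ y, U s x z * G z y * coeff (Finsupp.single t 1) (B y x) :=
          Finset.sum_congr rfl fun x _ => Finset.sum_comm
      _ = ∑ z, ∑ x, ∑ y, U s x z * G z y * coeff (Finsupp.single t 1) (B y x) := Finset.sum_comm
      _ = ∑ z, ∑ x, ∑ y, U s x z * (G z y * coeff (Finsupp.single t 1) (B y x)) :=
          Finset.sum_congr rfl fun z _ => Finset.sum_congr rfl fun x _ => Finset.sum_congr rfl fun y _ => by ring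
  rw [hfac]
  exact (Matrix.rank_mul_le_right _ _).trans (Matrix.rank_mul_le_right _ _)

end Rank

end Summit.ValiantsHypothesis.ValiantsHypothesis.Theorems.GrenetZeon.ThinNumerator

end
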